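import Mathlib

/-!
# HodgeLocusCensusLemmaW — LEMMA W of the `N = 1` Hodge-locus census (valuation trichotomy for `θ` and `θ − 1728`), kernel form (pub-hlocus, ENGINE B, abs-2 gen 21)

HONEST FRAMING: certified instances and evidence bearing on the general Hodge conjecture; no claim.

CELL V3-XT, `N = 1` (`DERIVATIONS_engineB.md` §13.1).  The recorded-open abs-layer item is: for every imaginary quadratic discriminant `D ∉ {−3, −4}`,
`θ = j(O_D)`, `F = ℚ(θ)`, the element `α₀ = θ(θ − 1728)` is not a square in `F`.  LEMMA W is the elementary engine behind THEOREMS A♯ / A⁺♯ of §13.2: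
at a prime `λ ∤ 6` of `F` (so `1728 = 2⁶3³` is a `λ`-unit) an algebraic integer `θ` and `θ − 1728` cannot both lie in `λ`; hence if `v_λ(θ − 1728)` is odd then
`v_λ(θ) = 0` and `v_λ(α₀)` is odd, so `α₀ ∉ F^{×2}`.  (WHERE an odd valuation of `θ − 1728` comes from — the Weber supplement and the genus criterion — is CM
theory and is NOT formalised; Mathlib has no ring class fields.)

THIS FILE proves LEMMA W for an ARBITRARY valuation `v : Valuation K Γ₀` on a field `K` (multiplicative notation: "unit" = value `1`, "in the maximal ideal" = value
`< 1`, "even valuation" = the value is a square in `Γ₀`), in particular for the `λ`-adic valuations `Valuation F ℤₘ₀` of number fields: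
* `unit_of_sub_lt`      : `v 1728 = 1 → v (θ − 1728) < 1 → v θ = 1`;
* `sub_unit_of_lt`      : `v 1728 = 1 → v θ < 1 → v (θ − 1728) = 1`;
* `not_both_lt`         : `v 1728 = 1 → ¬ (v θ < 1 ∧ v (θ − 1728) < 1)`  (the trichotomy);
* `unit_or_sub_unit`    : `v 1728 = 1 → v θ ≤ 1 → v θ = 1 ∨ v (θ − 1728) = 1`;
* `lemmaW`              : `v 1728 = 1 → v θ ≤ 1 → θ(θ − 1728) = y² → (v (θ − 1728)` and `v θ` are squares in `Γ₀)` — i.e. **if `α₀` is a square then both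
  valuations are even at every `λ ∤ 6` at which `θ` is integral**; its contrapositive `alpha_not_sq_of_val_not_sq` is the form used in §13.2.
No new definitions; no CM input; nothing here is specific to `j`-invariants except the constant `1728`, which enters only through the hypothesis `v 1728 = 1`.
Source: `data/abs/engineB/DERIVATIONS_engineB.md` §13 (pub-hlocus HOME); companion data: kit jobs j102094 / j102311 (T3: 0 violations of the trichotomy at the
primes over `l ≥ 5` tested; gen-19 bulk: 537314 determined primes `λ ∤ 6`, `|D| ≤ 10⁴`, 0 violations) — consistency evidence only, the lemma is unconditional.
-/

namespace Summit.HodgeConjecture.HodgeConjecture.HodgeLocus.Census.LemmaW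

variable {K Γ₀ : Type*} [Field K] [LinearOrderedCommGroupWithZero Γ₀] (v : Valuation K Γ₀)

/-- `θ ≡ 1728 (mod λ)` with `λ ∤ 6` forces `θ` to be a `λ`-unit. -/
theorem unit_of_sub_lt (θ : K) (h1728 : v 1728 = 1) (h : v (θ - 1728) < 1) : v θ = 1 := by
  have hid : θ = (θ - 1728) + 1728 := by ring
  have hlt : v (θ - 1728) < v (1728 : K) := by rw [h1728]; exact h
  rw [hid, Valuation.map_add_eq_of_lt_right v hlt, h1728]

/-- `θ ≡ 0 (mod λ)` with `λ ∤ 6` forces `θ − 1728` to be a `λ`-unit. -/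
theorem sub_unit_of_lt (θ : K) (h1728 : v 1728 = 1) (h : v θ < 1) : v (θ - 1728) = 1 := by
  have hid : θ - 1728 = θ + (-1728) := by ring
  have hneg : v (-1728 : K) = 1 := by rw [Valuation.map_neg, h1728]
  have hlt : v θ < v (-1728 : K) := by rw [hneg]; exact h
  rw [hid, Valuation.map_add_eq_of_lt_right v hlt, hneg]

/-- The trichotomy: `θ` and `θ − 1728` are not both in the maximal ideal of a valuation with `v 1728 = 1`. -/
theorem not_both_lt (θ : K) (h1728 : v 1728 = 1) : ¬ (v θ < 1 ∧ v (θ - 1728) < 1) := by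
  rintro ⟨h0, h1⟩
  have h := unit_of_sub_lt v θ h1728 h1
  rw [h] at h0
  exact lt_irrefl _ h0

/-- For `θ` integral at `λ ∤ 6`: `θ` or `θ − 1728` is a `λ`-unit. -/
theorem unit_or_sub_unit (θ : K) (h1728 : v 1728 = 1) (hθ : v θ ≤ 1) : v θ = 1 ∨ v (θ - 1728) = 1 := by
  rcases lt_or_eq_of_le hθ with h | h
  · exact Or.inr (sub_unit_of_lt v θ h1728 h)
  · exact Or.inl h

/-- LEMMA W: if `θ(θ − 1728)` is a square in `K`, then at every valuation with `v 1728 = 1` and `v θ ≤ 1` both `v (θ − 1728)` and `v θ` are squares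
in the value group ("even valuations"). -/
theorem lemmaW (θ y : K) (h1728 : v 1728 = 1) (hθ : v θ ≤ 1) (hy : θ * (θ - 1728) = y ^ 2) :
    (∃ g : Γ₀, v (θ - 1728) = g ^ 2) ∧ (∃ g : Γ₀, v θ = g ^ 2) := by
  have hprod : v θ * v (θ - 1728) = v y ^ 2 := by rw [← Valuation.map_mul, hy, Valuation.map_pow]
  rcases unit_or_sub_unit v θ h1728 hθ with h | h
  · refine ⟨⟨v y, ?_⟩, ⟨1, ?_⟩⟩
    · rw [h, one_mul] at hprod; exact hprod
    · rw [h, one_pow]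
  · refine ⟨⟨1, ?_⟩, ⟨v y, ?_⟩⟩
    · rw [h, one_pow]
    · rw [h, mul_one] at hprod; exact hprod

/-- The form used in THEOREMS A♯ / A⁺♯: an odd (= non-square) valuation of `θ − 1728` at a prime `λ ∤ 6` where `θ` is integral obstructs
`θ(θ − 1728)` from being a square. -/
theorem alpha_not_sq_of_val_not_sq (θ : K) (h1728 : v 1728 = 1) (hθ : v θ ≤ 1) (hodd : ¬ ∃ g : Γ₀, v (θ - 1728) = g ^ 2) :
    ¬ ∃ y : K, θ * (θ - 1728) = y ^ 2 := by
  rintro ⟨y, hy⟩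
  exact hodd (lemmaW v θ y h1728 hθ hy).1

/-- Symmetric form: an odd valuation of `θ` itself obstructs a square `θ(θ − 1728)`. -/
theorem alpha_not_sq_of_val_theta_not_sq (θ : K) (h1728 : v 1728 = 1) (hθ : v θ ≤ 1) (hodd : ¬ ∃ g : Γ₀, v θ = g ^ 2) :
    ¬ ∃ y : K, θ * (θ - 1728) = y ^ 2 := by
  rintro ⟨y, hy⟩
  exact hodd (lemmaW v θ y h1728 hθ hy).2

/-! ### A sanity anchor in `ℤ` (the class-number-one case `D = −7`, `θ = j = −3375`, `F = ℚ`): `j − 1728 = −5103 = −3⁶·7`, so `v₇(j − 1728) = 1` is odd and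
`v₇(j) = 0`; and indeed `j(j − 1728) = 17222625 = 3⁹·5³·7` has `v₇ = 1`, so it is not a rational square.  (Fixes the constant/sign conventions: `1728`, `θ − 1728`.) -/
/-- Sanity anchor (`D = −7`, `j = −3375`): `j − 1728 = −3⁶·7` and `j(j − 1728) = 3⁹·5³·7` (so `v₇ = 1`: not a rational square). -/
theorem anchor_D7 : (-3375 : ℤ) - 1728 = -(3 ^ 6 * 7) ∧ (-3375 : ℤ) * (-3375 - 1728) = 3 ^ 9 * 5 ^ 3 * 7 := by
  constructor <;> norm_num

end Summit.HodgeConjecture.HodgeConjecture.HodgeLocus.Census.LemmaW
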